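import Summits.FinalStateConjecture.FinalStateConjecture.Theorems.EIHFluxBalanceInertialRecessionRechartCausalKit

/-!
# Route EIHFluxBalance — `InertialRecession`, re-charting: the ZONE LEMMA with the inner
# dictionary only

Helper file for the crux `stmt-FinalStateConjecture-10166`
(`Summit.FinalStateConjecture.FinalStateConjecture.Theses.EIHFluxBalance.InertialRecession`),
stub `stub_rechart` of line `sublinear-is-free-clean-window-charges`.

`mem_causalPast_slab_of_zone'`: the zone lemma of `…RechartZone` with its model-to-lab
dictionary hypothesis weakened to the form the re-charted hole charts actually satisfy — the
painted radius of a late lab point `x` with `Φ x = ψᵢ y` equals `r(y)` whenever `r(y) < Rzᵢ`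
(inside the zone; far out the hole charts compress radii). A future causal curve of late chart
points (lab time `≥ τ₁`) from a hole-chart point with hole time `≤ τ₁` inside radius `Rzᵢ`, whose
endpoint has hole time `≥ τ₁` if still inside, reaches `J⁻` of the tilted slab
`ψᵢ{t* = τ₁, r ≤ Rᵢ(τ₁)}`: first exit parameter from the zone (`sInf` of a closed set),
intermediate values of the painted radius through `Φ` and of the hole time through `ψᵢ`
(`exists_mem_Icc_apply_eq_of_curve`), certified static flow at the exit point.

[O'Neill 1983, Ch. 14, pp. 402–404; folklore causal bookkeeping]
-/

noncomputable section

set_option linter.dupNamespace false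

open Set Filter Topology Function TopologicalSpace Literature.Geometry.Lorentzian
open scoped Manifold ContDiff

namespace Summit.FinalStateConjecture.FinalStateConjecture.Theorems

/-- First-exit bookkeeping (registered helper stub `csInf_mem_of_isClosed_rechart` of the crux
item): a nonempty closed set of reals bounded below contains its infimum, which is a lower bound.
[folklore] -/
theorem csInf_mem_of_isClosed_rechart : ∀ {s : Set ℝ} {a : ℝ}, IsClosed s → s.Nonempty → (∀ x ∈ s, a ≤ x) → sInf s ∈ s ∧ ∀ x ∈ s, sInf s ≤ x :=
  fun hs hne hbd ↦ ⟨hs.csInf_mem hne ⟨_, hbd⟩, fun _ hx ↦ csInf_le ⟨_, hbd⟩ hx⟩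

section Transfer

variable {𝓢 : Spacetime 4} {N : ℕ} (U : Opens E4) (Φ : U → 𝓢.carrier) (O : Set 𝓢.carrier)
  (Pext : U → Prop) (rp : Fin N → U → ℝ) (rH δ Rz : Fin N → ℝ)
  (Kb : Fin N → ModelBackground) (ψ : ∀ i, (Kb i).domain → 𝓢.carrier)
  (R : Fin N → ℝ → ℝ) (hRm : ∀ i, Monotone (R i))
  (U₀ : Opens E4) (hU₀ : U₀ ≤ U) (Rb T₂ : ℝ → ℝ) (α β : Fin N → ℝ) {τ₀ τ₀' τT Tc S : ℝ}
  (hτ : τ₀ < τ₀') (hτT : τT < τ₀') (hTc : Tc ≤ τ₀') (hβ : ∀ i, 0 ≤ β i) (hα : ∀ i, 0 < α i)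
  -- exhaustion (vii), lab-time causality, `O` below the late image
  (hexh : ∀ t₁ : ℝ, τ₀ < t₁ → O \ Φ '' {x : U | t₁ < x.1 0 ∧ Pext x} ⊆
    𝓢.metric.causalPast 𝓢.timeOrientation (Φ '' {x : U | x.1 0 = t₁ ∧ Pext x}))
  (hT : ∀ x x' : U, τT < x.1 0 → Pext x → τT < x'.1 0 → Pext x' →
    Φ x' ∈ 𝓢.metric.causalFuture 𝓢.timeOrientation {Φ x} → x.1 0 ≤ x'.1 0)
  (hOcl : ∀ p ∈ O, ∀ z : 𝓢.carrier, z ∈ 𝓢.metric.causalFuture 𝓢.timeOrientation {p} →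
    z ∈ 𝓢.metric.causalPast 𝓢.timeOrientation (Φ '' {x : U | τ₀ < x.1 0 ∧ Pext x}) → z ∈ O)
  (himO : Φ '' {x : U | τ₀ < x.1 0 ∧ Pext x} ⊆ O)
  -- the charts
  (hemb : IsOpenEmbedding (({x : U | τ₀ < x.1 0} : Set U).restrict Φ))
  (hrpc : ∀ i, Continuous (rp i))
  (hψemb : ∀ i, IsOpenEmbedding (ψ i)) (hKt : ∀ i, Continuous (Kb i).time)
  (hKr : ∀ i, Continuous (Kb i).radius)
  (hlab : ∀ (i : Fin N) (y : (Kb i).domain) (x : U), Φ x = ψ i y → Tc ≤ x.1 0 →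
    (Kb i).radius y.1 < Rz i → rp i x = (Kb i).radius y.1)
  (hsplit : ∀ x : U, τ₀' ≤ x.1 0 → Pext x → x.1 ∈ (U₀ : Set E4) ∨ ∃ i, rp i x ≤ Rb (x.1 0))
  (hPext : ∀ (x : U) (i : Fin N), Pext x → rH i < rp i x)
  (hcov : ∀ (i : Fin N) (x : U), Tc ≤ x.1 0 → rH i < rp i x → rp i x ≤ Rb (x.1 0) →
    ∃ y : (Kb i).domain, ψ i y = Φ x ∧ (Kb i).radius y.1 = rp i x ∧
      |(Kb i).time y.1 - α i * x.1 0| ≤ β i * rp i x)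
  (hRz : ∀ (i : Fin N) (t : ℝ), τ₀' ≤ t → Rz i ≤ Rb t) (hδRz : ∀ i, rH i + δ i ≤ Rz i)
  (hT₂ : ∀ (i : Fin N) (τ₁ : ℝ), (τ₁ + β i * Rz i) / α i ≤ T₂ τ₁ ∧ τ₁ ≤ T₂ τ₁)
  -- certified static flow, meshing
  (hstat : ∀ (i : Fin N) (y : (Kb i).domain) (τ₁ : ℝ), τ₀' ≤ τ₁ → S ≤ (Kb i).time y.1 →
    (Kb i).time y.1 ≤ τ₁ → rH i + δ i ≤ (Kb i).radius y.1 →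
    (Kb i).radius y.1 ≤ R i ((Kb i).time y.1) →
      ψ i y ∈ 𝓢.metric.causalPast 𝓢.timeOrientation (ψ i '' (Kb i).truncTimeSlab (R i τ₁) τ₁))
  (hmesh : ∀ (i : Fin N) (t : ℝ), τ₀' ≤ t → S ≤ α i * t - β i * Rb t ∧
    Rb t ≤ R i (α i * t - β i * Rb t) ∧ α i * t + β i * Rb t ≤ t)
  (hzone : ∀ (i : Fin N) (t : ℝ), τ₀' ≤ t → S ≤ α i * t - β i * Rz i ∧
    Rz i ≤ R i (α i * t - β i * Rz i) ∧ Rz i ≤ R i t)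

include hRm hTc hemb hrpc hψemb hKt hKr hlab hPext hcov hRz hδRz hstat hzone in
/-- **The zone lemma.** Let `γ` be a future causal curve on `[a, b]` of late chart points with lab
time `≥ τ₁`, starting at a hole-chart point `ψᵢ y₁` with `t*(y₁) ≤ τ₁` and `r(y₁) < Rzᵢ`, whose
endpoint has hole time `≥ τ₁` if it is still within radius `Rzᵢ` of hole `i`. Then `γ a` lies in
`J⁻` of the slab `ψᵢ{t* = τ₁, r ≤ Rᵢ(τ₁)}`: either the hole time `τ₁` is taken along the curve
inside the zone `{r < Rzᵢ}` (intermediate values through `ψᵢ`), or the curve first leaves the zone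
(`sInf` of the closed exit set) at a point of painted radius exactly `Rzᵢ` (intermediate values of
the painted radius through `Φ`, and coverage), which is certified (`Rzᵢ ≥ r₊ + δ`) with hole time
`< τ₁`, so that the static flow carries it to the slab. Variant of `mem_causalPast_slab_of_zone`
(`…RechartZone`) with the model-to-lab dictionary required only INSIDE the zone (the re-charted
hole charts compress radii far out). [folklore] -/
theorem mem_causalPast_slab_of_zone' (i : Fin N) (τ₁ : ℝ) (hτ₁ : τ₀' ≤ τ₁)
    {γ : ℝ → 𝓢.carrier} {a b : ℝ} (hab : a ≤ b)
    (hγ : 𝓢.metric.IsFutureCausalCurveOn 𝓢.timeOrientation γ (Icc a b))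
    (hlate : ∀ s ∈ Icc a b, ∃ x : U, Φ x = γ s ∧ τ₀ < x.1 0 ∧ Pext x ∧ τ₁ ≤ x.1 0)
    (y₁ : (Kb i).domain) (hy₁ : ψ i y₁ = γ a) (hy₁t : (Kb i).time y₁.1 ≤ τ₁)
    (hy₁r : (Kb i).radius y₁.1 < Rz i)
    (hend : ∀ y : (Kb i).domain, ψ i y = γ b → (Kb i).radius y.1 < Rz i →
      τ₁ ≤ (Kb i).time y.1) :
    γ a ∈ 𝓢.metric.causalPast 𝓢.timeOrientation (ψ i '' (Kb i).truncTimeSlab (R i τ₁) τ₁) := by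
  set slab : Set 𝓢.carrier := ψ i '' (Kb i).truncTimeSlab (R i τ₁) τ₁ with hslab
  set W : Set 𝓢.carrier := ψ i '' {y | (Kb i).radius y.1 < Rz i} with hW
  have hWo : IsOpen W :=
    (hψemb i).isOpenMap _ (isOpen_lt ((hKr i).comp continuous_subtype_val) continuous_const)
  have hγc : ContinuousOn γ (Icc a b) := continuousOn_of_isFutureCausalCurveOn hγ
  -- injectivity of the lab chart on the late region
  have hinj : ∀ x x' : U, τ₀ < x.1 0 → τ₀ < x'.1 0 → Φ x = Φ x' → x = x' := by
    intro x x' hx hx' h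
    have := hemb.injective
      (show ({x : U | τ₀ < x.1 0} : Set U).restrict Φ ⟨x, hx⟩ =
        ({x : U | τ₀ < x.1 0} : Set U).restrict Φ ⟨x', hx'⟩ from h)
    exact congrArg Subtype.val this
  -- painted radius of zone points
  have hWrad : ∀ (s : ℝ) (x : U), Tc ≤ x.1 0 → Φ x = γ s → γ s ∈ W → rp i x < Rz i := by
    rintro s x hx hxs ⟨y, hy, hys⟩
    rw [hlab i y x (hxs.trans hys.symm) hx hy]; exact hy
  have hconcl : ∀ s ∈ Icc a b, γ s ∈ slab →
      γ a ∈ 𝓢.metric.causalPast 𝓢.timeOrientation slab := fun s hs h ↦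
    mem_causalPast_of_curve hγ hs h
  -- the exit set
  set B : Set ℝ := Icc a b ∩ γ ⁻¹' Wᶜ with hB
  have hBc : IsClosed B := hγc.preimage_isClosed_of_isClosed isClosed_Icc hWo.isClosed_compl
  have haW : γ a ∈ W := ⟨y₁, hy₁r, hy₁⟩
  by_cases hBne : B.Nonempty
  · -- EXIT: the curve leaves the zone, first at `σ₂`
    set σ₂ : ℝ := sInf B with hσ₂
    have hbdd : BddBelow B := ⟨a, fun s hs ↦ hs.1.1⟩
    have hσ₂B : σ₂ ∈ B := hBc.csInf_mem hBne hbdd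
    have hσ₂I : σ₂ ∈ Icc a b := hσ₂B.1
    have hσ₂W : γ σ₂ ∉ W := hσ₂B.2
    have hbefore : ∀ s, a ≤ s → s < σ₂ → γ s ∈ W := fun s has hs ↦ by
      by_contra h
      have : σ₂ ≤ s := csInf_le hbdd ⟨⟨has, hs.le.trans hσ₂I.2⟩, h⟩
      linarith
    have haσ₂ : a < σ₂ := lt_of_le_of_ne hσ₂I.1 fun h ↦ hσ₂W (h ▸ haW)
    obtain ⟨x₂, hx₂, hx₂0, hx₂P, hx₂τ⟩ := hlate σ₂ hσ₂I
    have hx₂τ' : τ₀' ≤ x₂.1 0 := hτ₁.trans hx₂τ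
    -- the painted radius at the exit point is exactly `Rz i`
    have hle : rp i x₂ ≤ Rz i := by
      by_contra h
      rw [not_le] at h
      obtain ⟨xa, hxa, hxa0, -, hxaτ⟩ := hlate a ⟨le_rfl, hab⟩
      have hxar : rp i xa < Rz i := hWrad a xa (hTc.trans (hτ₁.trans hxaτ)) hxa haW
      have hmaps : MapsTo γ (Icc a σ₂) (range (({x : U | τ₀ < x.1 0} : Set U).restrict Φ)) := by
        intro s hs
        obtain ⟨x, hx, hx0, -, -⟩ := hlate s ⟨hs.1, hs.2.trans hσ₂I.2⟩
        exact ⟨⟨x, hx0⟩, hx⟩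
      have hlateTc : ∀ s ∈ Icc a σ₂, ∀ x : U, Φ x = γ s → τ₀ < x.1 0 → Tc ≤ x.1 0 := by
        intro s hs x hx hx0
        obtain ⟨x', hx', hx'0, -, hx'τ⟩ := hlate s ⟨hs.1, hs.2.trans hσ₂I.2⟩
        have : x' = x := hinj x' x hx'0 hx0 (hx'.trans hx.symm)
        rw [← this]; exact hTc.trans (hτ₁.trans hx'τ)
      obtain ⟨s, hs, ⟨x, hx0⟩, hxs, hxr⟩ := exists_mem_Icc_apply_eq_of_curve hemb haσ₂.le
        (hγc.mono (Icc_subset_Icc le_rfl hσ₂I.2)) hmaps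
        (f := fun x : ({x : U | τ₀ < x.1 0} : Set U) ↦ rp i x.1)
        ((hrpc i).comp continuous_subtype_val)
        (xa := ⟨xa, hxa0⟩) (xb := ⟨x₂, hx₂0⟩) hxa hx₂ (c := Rz i) hxar.le h.le
      rcases eq_or_lt_of_le hs.2 with hsσ | hsσ
      · have : x = x₂ := hinj x x₂ hx0 hx₂0 (hxs.trans (hsσ ▸ hx₂).symm)
        have hxr' : rp i x = Rz i := hxr
        rw [this] at hxr'
        linarith
      · have h1 := hWrad s x (hlateTc s hs x hxs hx0) hxs (hbefore s hs.1 hsσ)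
        have hxr' : rp i x = Rz i := hxr
        linarith
    have hge : Rz i ≤ rp i x₂ := by
      by_contra h
      rw [not_le] at h
      obtain ⟨y, hyψ, hyr, -⟩ := hcov i x₂ (hTc.trans hx₂τ') (hPext x₂ i hx₂P)
        (h.le.trans (hRz i _ hx₂τ'))
      exact hσ₂W ⟨y, by rw [mem_setOf_eq, hyr]; exact h, hyψ.trans hx₂⟩
    obtain ⟨y₂, hy₂ψ, hy₂r, hy₂t⟩ := hcov i x₂ (hTc.trans hx₂τ') (hPext x₂ i hx₂P)
      (hle.trans (hRz i _ hx₂τ'))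
    have hx₂r : rp i x₂ = Rz i := le_antisymm hle hge
    rw [hx₂r] at hy₂r hy₂t
    have hy₂γ : ψ i y₂ = γ σ₂ := hy₂ψ.trans hx₂
    -- up to `σ₂` the curve runs in the image of `ψ i`
    have hmapsψ : MapsTo γ (Icc a σ₂) (range (ψ i)) := by
      intro s hs
      rcases eq_or_lt_of_le hs.2 with h | h
      · rw [h, ← hy₂γ]; exact mem_range_self _
      · obtain ⟨y, -, hy⟩ := hbefore s hs.1 h
        exact ⟨y, hy⟩
    obtain ⟨hS, hRzR, -⟩ := hzone i (x₂.1 0) hx₂τ'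
    obtain ⟨-, -, hRzτ⟩ := hzone i τ₁ hτ₁
    rcases le_or_gt τ₁ ((Kb i).time y₂.1) with ht | ht
    · -- the hole time `τ₁` is taken on `[a, σ₂]`
      obtain ⟨s, hs, y, hys, hyt⟩ := exists_mem_Icc_apply_eq_of_curve (hψemb i) haσ₂.le
        (hγc.mono (Icc_subset_Icc le_rfl hσ₂I.2)) hmapsψ
        (f := fun y : (Kb i).domain ↦ (Kb i).time y.1) ((hKt i).comp continuous_subtype_val)
        (xa := y₁) (xb := y₂) hy₁ hy₂γ hy₁t ht
      have hyr : (Kb i).radius y.1 ≤ Rz i := by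
        rcases eq_or_lt_of_le hs.2 with h | h
        · have : y = y₂ := (hψemb i).injective (hys.trans (h ▸ hy₂γ.symm))
          rw [this, hy₂r]
        · obtain ⟨y', hy'r, hy'⟩ := hbefore s hs.1 h
          have : y' = y := (hψemb i).injective (hy'.trans hys.symm)
          rw [← this]; exact le_of_lt hy'r
      refine hconcl s ⟨hs.1, hs.2.trans hσ₂I.2⟩ ⟨y, ?_, hys⟩
      rw [ModelBackground.mem_truncTimeSlab]
      exact ⟨hyt, hyr.trans hRzτ⟩
    · -- exit at a certified point with hole time `< τ₁`: static flow to the slab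
      have ht1 : α i * x₂.1 0 - β i * Rz i ≤ (Kb i).time y₂.1 := by
        have := (abs_le.mp hy₂t).1; linarith
      have hy₂J := hstat i y₂ τ₁ hτ₁ (hS.trans ht1) ht.le (by rw [hy₂r]; exact hδRz i)
        (by rw [hy₂r]; exact hRzR.trans (hRm i ht1))
      rw [hy₂γ] at hy₂J
      exact mem_causalPast_of_subset_causalPast
        (WithTop.coe_le_coe.mpr le_top : (2 : ℕ∞ω) ≤ ∞)
        (mem_causalPast_singleton_of_curve hγ hσ₂I) (singleton_subset_iff.mpr hy₂J)
  · -- WHOLE: the curve never leaves the zone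
    have hallW : ∀ s ∈ Icc a b, γ s ∈ W := fun s hs ↦ by
      by_contra h
      exact hBne ⟨s, hs, h⟩
    obtain ⟨yb, hybr, hyb⟩ := hallW b ⟨hab, le_rfl⟩
    have hybt : τ₁ ≤ (Kb i).time yb.1 := hend yb hyb hybr
    have hmapsψ : MapsTo γ (Icc a b) (range (ψ i)) := fun s hs ↦ by
      obtain ⟨y, -, hy⟩ := hallW s hs
      exact ⟨y, hy⟩
    obtain ⟨s, hs, y, hys, hyt⟩ := exists_mem_Icc_apply_eq_of_curve (hψemb i) hab hγc hmapsψ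
      (f := fun y : (Kb i).domain ↦ (Kb i).time y.1) ((hKt i).comp continuous_subtype_val)
      (xa := y₁) (xb := yb) hy₁ hyb hy₁t hybt
    obtain ⟨y', hy'r, hy'⟩ := hallW s hs
    have hyy : y' = y := (hψemb i).injective (hy'.trans hys.symm)
    obtain ⟨-, -, hRzτ⟩ := hzone i τ₁ hτ₁
    refine hconcl s hs ⟨y, ?_, hys⟩
    rw [ModelBackground.mem_truncTimeSlab]
    exact ⟨hyt, (hyy ▸ hy'r).le.trans hRzτ⟩

end Transfer

end Summit.FinalStateConjecture.FinalStateConjecture.Theorems
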